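import Summits.QuantumFields.BalabanUV.Beta.D1BFx.GhostRelegging
import Summits.QuantumFields.BalabanUV.Beta.D1BFx.ShellGradedRoad

/-!
# `BalabanUV.Beta.D1BFx.GhostReleggingShell` — road «BF-x» for binder row D1, sub-leaf A2′-SHELL: LEAF-10's RE-LEGGING BOUND (A2′)
# WITH THE MIXED-SECOND-DIFFERENCE ROWS `h2`/`d2` IN SHELL-ℓ¹ CURRENCY (the A2′ twin of leaf-07's C3-SHELL, owner R-7)

HONEST DEPENDENCY (page 1, mandatory): continuum YM on T⁴ ⇐ BetaPertH ∧ nine spine estimates (0/9 proved); BetaPertH ⇐ (D1) ∧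
(D4) ∧ CAP+tail; G-an2-4 gates asym, D1 and NE2/3/4.  HONEST FRAMING (cell contract, verbatim): «discharging `BetaPertH` makes
Bałaban's UV stability UNCONDITIONAL — a real constructive-QFT result; it is NOT the continuum limit and NOT the Clay problem.»
THIS MODULE DISCHARGES NOTHING of the wall: [folklore] window/tail bookkeeping BY NAME over leaf-10's `GhostRelegging` (`stKI`,
`tailConst_nonneg`), leaf-07-g4's shell machinery (`ShellWindowLegs.shellWindow_of_legRows`/`shellTail_of_legRows`, `ShellStencils`,
`ShellWindowInterface.window_sub_le_of_shellRows`, `ShellFullSum.abs_fullSum_sub_psum_le_shell`) and an3's `SquareTable`.  Every row is a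
HYPOTHESIS with free constants on two FREE leg families; NO analytic row for any actual leg is proved here (for the ghost leg `Ggh`,
`GhostLegFree.ghLeg_rows` supplies `h0/h1/d0/d1`; its `h2s/d2s` are OPEN).  No `def`, no `Prop` mirror, no cited fact, 0 sorry; 0 wall binders
instantiated; NOT D1, NOT `BetaPertH`, NOT continuum, NOT Clay.

ABSOLUTE RULE (cell charter, verbatim): «No internally-minted statement may enter as a cited fact. Every hypothesis is either
kernel-proved in this package or a verbatim quotation of a PUBLISHED theorem with page reference. The manuscript(s) under audit are NOT
citable for their own disputed steps — they are the thing under adjudication; programme-internal (2001/route/tribunal) claims are never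
citable.»

WHY (`HOME/b2b-balaban-beta-d1-p2/OWNER-RULINGS-1.md` R-7, verbatim in substance: «A2′ `GhostRelegging`'s END may be re-pointed to shell rows
the same way (designation {inr true})»; leaf-07-g4 HANDOFF).  Leaf-10's `GhostRelegging.abs_fullSum_stKI_sub_le` takes, for each of two leg
families, the six POINTWISE graded rows `h0/h1/h2/d0/d1/d2`; leaf-07 gen 3 found (evidence-grade) that the pointwise mixed second difference
`h2` is off by `log n` on the block-edge layer for the actual legs, while its SHELL SUMS are of the typed size, and re-typed the road END
accordingly (`ShellRoadEnd.d1Drift_of_strongRoad_shell`).  This file does the same for A2′, for ANY index sub-family `I ⊆ BfIdx`.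

CONTENT ([folklore] throughout; `n ≥ 2` one blocking factor, window cut-off `M n := n` as in C3/C3-SHELL).
* §1 ONE FAMILY: `stKI_sub_free` (the `I`-sector kernel minus its free-leg value, termwise); **`shellWindow_stKI`** — rows `h0/h1`
  pointwise + `h2s` ⟹ `Σ_{‖w‖∞=r+1}|stKI I G w − stKI I gFree w| ≤ Dsh/n` on every window shell `r + 1 ≤ n`; **`shellTail_stKI`** — rows
  `d0/d1` pointwise + `d2s` ⟹ `Σ_{‖w‖∞=r+1}|stKI I G w| ≤ 80·Et·(r+1)⁻¹·e^{−(δ/n)(r+1)}` on every exterior shell `r ≥ n` (designated set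
  `{inr true}`: its first leg is the VALUE — pointwise —, its second leg the MIXED DIFFERENCE — shell; every other index the mirror
  assignment; the per-index blocks are leaf-07-g4's `ShellGradedRoad` blocks at a single scale).
* §2 TWO FAMILIES: **`abs_fullSum_stKI_sub_le_shell`** — `|fullSum (stKI I G₁) − fullSum (stKI I G₂)| ≤ 2·Dsh + 2·80·Et·(1 + 1/δ)`
  (window: `window_sub_le_of_shellRows` on the difference; tails: `abs_fullSum_sub_psum_le_shell` per family).
* (part 2, `D1BFx/GhostReleggingShellAvg`) `abs_avg_fullSum_stKI_sub_le_shell`, `exists_avg_relegging_bound_shell` — base-point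
  averaged, all scales; binder list = the rows of `ShellRoadEnd.d1Drift_of_strongRoad_shell` for each family (VERBATIM shapes).
The tree's pointwise `h2`/`d2` imply `h2s`/`d2s` (`#shell ≤ 80(r+1)³`), so every statement here is strictly MORE GENERAL than its A2′ original.
Unit `b2b-balaban-beta-d1-formalise-leaf-04` (gen 2), D1 formalisation swarm; `LEAVES-BFx.md` sub-row A2′-SHELL.
-/

namespace Summit.QuantumFields.BalabanUV.Beta.D1BFx.GhostReleggingShell

open Finset Filter Topology
open scoped BigOperators
open Literature.Probability.LatticeModels (annulus)
open Literature.MathematicalPhysics.QuantumFieldTheory.Balaban1983to89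
open Literature.MathematicalPhysics.QuantumFieldTheory.Balaban1983to89.Beta
open DyadicShell (Pt toReal supNorm supNorm_eq_of_mem_sphere ne_zero_of_mem_annulus mem_annulus_iff)
open BubbleTransfer (Leg unitVec)
open GhostTable (gFree)
open SquareTable (BfIdx bfCoeff bfP bfQ stP stQ hdeg_bf stP_free stQ_free stP_sub stQ_sub two_le_bfQ_a)
open WindowInterface (windowBound_of_scaleBound)
open WindowIdentification (psum fullSum psum_def)
open Summit.QuantumFields.BalabanUV.Beta.D1BFx.GhostRelegging (stKI tailConst_nonneg)
open Summit.QuantumFields.BalabanUV.Beta.D1BFx.ShellStencils (stP_inr_true stQ_inr_true a_bfP_inr_true a_bfP_inr_true_sub a_bfQ_inr_true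
  a_bfQ_inr_true_sub stP_low abs_stQ_low_le abs_stQ_low_le_of_decay shell_sum_le_of_pointwise window_shape_le tail_shape_le grad_shape_le)
open Summit.QuantumFields.BalabanUV.Beta.D1BFx.ShellWindowLegs (shellWindow_of_legRows shellTail_of_legRows)
open Summit.QuantumFields.BalabanUV.Beta.D1BFx.ShellWindowInterface (window_sub_le_of_shellRows)
open Summit.QuantumFields.BalabanUV.Beta.D1BFx.ShellFullSum (abs_fullSum_sub_psum_le_shell)

noncomputable section

variable {μ ν : Fin 4}

/-! ## §1 One family, one scale: the window and exterior shell rows of the `I`-sector kernel -/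

section OneFamily

/-- [folklore] The `I`-sector kernel minus its free-leg value, termwise (`stP_free`/`stQ_free`). -/
theorem stKI_sub_free (hμν : μ ≠ ν) (N : ℝ) (I : Finset BfIdx) (G : Pt → ℝ) (n : ℕ) (w : Pt) :
    stKI μ ν N I G w - stKI μ ν N I gFree w =
      toReal w μ * toReal w ν * ∑ i ∈ I, bfCoeff N i * (stP μ ν G i w * stQ μ ν G i w - (bfP hμν i).f n 0 w * (bfQ hμν i).f n 0 w) := by
  simp only [stKI, stP_free hμν _ n 0, stQ_free hμν _ n 0, ← mul_sub, ← Finset.sum_sub_distrib]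

/-- [folklore] The window constant `Dsh` is non-negative. -/
theorem shellWinConst_nonneg (hμν : μ ≠ ν) (N : ℝ) (I : Finset BfIdx) {D : ℕ → ℝ} (hD : ∀ j, 0 ≤ D j) :
    0 ≤ ∑ i ∈ I, |bfCoeff N i| *
        (80 * (((bfP hμν i).A + (bfP hμν i).B) * (80 * D ((bfQ hμν i).a - 2)) +
            80 * D ((bfP hμν i).a - 2) * ((bfQ hμν i).A + (bfQ hμν i).B)) +
          80 * D ((bfP hμν i).a - 2) * (80 * D ((bfQ hμν i).a - 2))) := by
  refine Finset.sum_nonneg fun i _ => mul_nonneg (abs_nonneg _) ?_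
  have := (bfP hμν i).nonneg_A; have := (bfP hμν i).nonneg_B; have := (bfQ hμν i).nonneg_A; have := (bfQ hμν i).nonneg_B
  have := hD ((bfP hμν i).a - 2); have := hD ((bfQ hμν i).a - 2)
  positivity

/-- [folklore] **THE WINDOW SHELL ROW OF THE `I`-SECTOR KERNEL** (one family, one scale `n ≥ 2`): the pointwise rows `h0`/`h1` and the
SHELL row `h2s` for `E = G − gFree` give, on every window shell `‖w‖∞ = r + 1 ≤ n`,
`Σ_{‖w‖∞=r+1}|stKI I G w − stKI I gFree w| ≤ Dsh/n` — leaf-07-g4's `shellWindow_of_legRows` with the designated set `{inr true}`. -/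
theorem shellWindow_stKI (hμν : μ ≠ ν) (N : ℝ) (I : Finset BfIdx) {n : ℕ} (hn : 2 ≤ n) {G : Pt → ℝ} {D : ℕ → ℝ}
    (hD : ∀ j, 0 ≤ D j)
    (h0 : ∀ v, |G v - gFree v| ≤ D 0 / (n : ℝ) ^ 2)
    (h1 : ∀ v (ρ : Fin 4), |(G (v + unitVec ρ) - gFree (v + unitVec ρ)) - (G v - gFree v)| ≤ D 1 / (n : ℝ) ^ 3)
    (h2s : ∀ r : ℕ, r + 1 ≤ n →
      ∑ v ∈ annulus 4 r (r + 1), |(G (v + unitVec ν + unitVec μ) - gFree (v + unitVec ν + unitVec μ)) -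
          (G (v + unitVec ν) - gFree (v + unitVec ν)) - (G (v + unitVec μ) - gFree (v + unitVec μ)) + (G v - gFree v)| ≤ D 2 / (n : ℝ))
    {r : ℕ} (hr : r + 1 ≤ n) :
    ∑ w ∈ annulus 4 r (r + 1), |stKI μ ν N I G w - stKI μ ν N I gFree w| ≤
      (∑ i ∈ I, |bfCoeff N i| *
        (80 * (((bfP hμν i).A + (bfP hμν i).B) * (80 * D ((bfQ hμν i).a - 2)) +
            80 * D ((bfP hμν i).a - 2) * ((bfQ hμν i).A + (bfQ hμν i).B)) +
          80 * D ((bfP hμν i).a - 2) * (80 * D ((bfQ hμν i).a - 2)))) / n := by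
  classical
  have hn0 : (0 : ℝ) < n := by exact_mod_cast (show 0 < n by omega)
  have hmem : ∀ i : BfIdx, i ∉ ({Sum.inr true} : Finset BfIdx) ↔ i ≠ Sum.inr true := fun i => by simp
  have hR : ∀ i ∈ I, 0 ≤ 80 * D ((bfP hμν i).a - 2) := fun i _ => by have := hD ((bfP hμν i).a - 2); positivity
  have hS : ∀ i ∈ I, 0 ≤ 80 * D ((bfQ hμν i).a - 2) := fun i _ => by have := hD ((bfQ hμν i).a - 2); positivity
  have eP : ∀ (i : BfIdx) (w : Pt), stP μ ν G i w - (bfP hμν i).f n 0 w = stP μ ν (G - gFree) i w := fun i w => by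
    rw [← stP_free hμν i n 0 w, stP_sub]
  have eQ : ∀ (i : BfIdx) (w : Pt), stQ μ ν G i w - (bfQ hμν i).f n 0 w = stQ μ ν (G - gFree) i w := fun i w => by
    rw [← stQ_free hμν i n 0 w, stQ_sub]
  have hsup : ∀ {r : ℕ} {w : Pt}, w ∈ annulus 4 r (r + 1) → (supNorm w : ℝ) = (r : ℝ) + 1 := fun hw => by
    rw [supNorm_eq_of_mem_sphere hw]; push_cast; ring
  have ht0 : (0 : ℝ) < (r : ℝ) + 1 := by positivity
  have hrn : (r : ℝ) + 1 ≤ (n : ℝ) := by exact_mod_cast hr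
  have h := shellWindow_of_legRows (fun i _ => hdeg_bf hμν i (Finset.mem_univ i)) μ ν ({Sum.inr true} : Finset BfIdx) (L := n) (k := 0)
    hr (F := fun i w => stP μ ν G i w) (G := fun i w => stQ μ ν G i w) (cc₀ := bfCoeff N)
    (R := fun i => 80 * D ((bfP hμν i).a - 2)) (S := fun i => 80 * D ((bfQ hμν i).a - 2)) hR hS ?_ ?_ ?_ ?_
  · simpa only [stKI_sub_free hμν N I G n] using h
  · -- hFpt: the designated first leg is the VALUE `E(w)`: pointwise from `h0`
    intro i _ hiF w hw
    rw [Finset.mem_singleton] at hiF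
    subst hiF
    have hw0 : w ≠ 0 := ne_zero_of_mem_annulus hw
    have hwM : (supNorm w : ℝ) ≤ (n : ℝ) := by rw [hsup hw]; exact hrn
    show |stP μ ν G (Sum.inr true) w - (bfP hμν (Sum.inr true)).f n 0 w| ≤ _
    rw [eP, stP_inr_true, a_bfP_inr_true_sub]
    refine windowBound_of_scaleBound (a := 2) (by have := hD 0; positivity) le_rfl hw0 hwM ?_
    have h := h0 w
    simp only [Pi.sub_apply] at h ⊢
    refine h.trans ?_
    exact div_le_div_of_nonneg_right (by linarith [hD 0]) (by positivity)
  · -- hGsh: the designated second leg is the MIXED DIFFERENCE at `w`: shell row `h2s`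
    intro i _ hiF
    rw [Finset.mem_singleton] at hiF
    subst hiF
    show ∑ w ∈ annulus 4 r (r + 1), |stQ μ ν G (Sum.inr true) w - (bfQ hμν (Sum.inr true)).f n 0 w| ≤ _
    simp_rw [eQ, stQ_inr_true, a_bfQ_inr_true_sub, a_bfQ_inr_true]
    have h := h2s r hr
    simp only [Pi.sub_apply] at h ⊢
    exact h.trans (window_shape_le ht0 hn0 (by linarith [hD 2]))
  · -- hGpt: off the ghost index the second leg is a value or a gradient: pointwise from `h0`/`h1`
    intro i _ hiF w hw
    rw [hmem] at hiF
    have hw0 : w ≠ 0 := ne_zero_of_mem_annulus hw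
    have hwM : (supNorm w : ℝ) ≤ (n : ℝ) := by rw [hsup hw]; exact hrn
    show |stQ μ ν G i w - (bfQ hμν i).f n 0 w| ≤ _
    rw [eQ]
    have key := abs_stQ_low_le hμν i hiF (G - gFree) w (e := fun j => D j / (n : ℝ) ^ (j + 2))
      (by simpa using h0 (w + (unitVec μ + unitVec ν))) (by simpa using h0 (w + unitVec ν))
      (by have h := h1 (w + unitVec μ) ν; simpa [add_assoc] using h) (by simpa using h1 w ν)
    have ha : (bfQ hμν i).a - 2 + 2 = (bfQ hμν i).a := Nat.sub_add_cancel (two_le_bfQ_a hμν i)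
    simp only [ha] at key
    refine (windowBound_of_scaleBound (hD _) (two_le_bfQ_a hμν i) hw0 hwM key).trans ?_
    apply div_le_div_of_nonneg_right _ (by positivity)
    linarith [hD ((bfQ hμν i).a - 2)]
  · -- hFsh: off the ghost index the first leg is the mixed difference (`h2s`) or the `μ`-gradient at `w` (pointwise `h1`, summed)
    intro i _ hiF
    rw [hmem] at hiF
    show ∑ w ∈ annulus 4 r (r + 1), |stP μ ν G i w - (bfP hμν i).f n 0 w| ≤ _
    simp_rw [eP]
    rcases stP_low hμν i hiF (G - gFree) with ⟨e, ha2, ha⟩ | ⟨e, ha1, ha⟩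
    · -- mixed difference, degree 4
      simp_rw [e, ha2, ha]
      have h := h2s r hr
      simp only [Pi.sub_apply] at h ⊢
      exact h.trans (window_shape_le ht0 hn0 (by linarith [hD 2]))
    · -- gradient, degree 3
      simp_rw [e, ha1, ha]
      have hpt : ∀ w ∈ annulus 4 r (r + 1), |(G - gFree) (w + unitVec μ) - (G - gFree) w| ≤ D 1 / (n : ℝ) ^ 3 :=
        fun w _ => by simpa using h1 w μ
      exact (shell_sum_le_of_pointwise (by have := hD 1; positivity) hpt).trans (grad_shape_le ht0 hn0 hrn (hD 1))

/-- [folklore] **THE EXTERIOR SHELL ROW OF THE `I`-SECTOR KERNEL** (one family, one scale `n ≥ 2`): the pointwise decay rows `d0`/`d1` and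
the SHELL row `d2s` give, on every exterior shell `‖w‖∞ = r + 1`, `r ≥ n`,
`Σ_{‖w‖∞=r+1}|stKI I G w| ≤ 80·Et·(r+1)⁻¹·e^{−(δ/n)(r+1)}` — leaf-07-g4's `shellTail_of_legRows` with the designated set `{inr true}`. -/
theorem shellTail_stKI (hμν : μ ≠ ν) (N : ℝ) (I : Finset BfIdx) {n : ℕ} (hn : 2 ≤ n) {G : Pt → ℝ} {A : ℕ → ℝ} (hA : ∀ j, 0 ≤ A j)
    {δ : ℝ} (hδ : 0 < δ)
    (d0 : ∀ v : Pt, v ≠ 0 → |G v| ≤ A 0 * Real.exp (-(δ / n) * supNorm v) / (supNorm v : ℝ) ^ 2)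
    (d1 : ∀ v : Pt, v ≠ 0 → ∀ ρ : Fin 4, |G (v + unitVec ρ) - G v| ≤ A 1 * Real.exp (-(δ / n) * supNorm v) / (supNorm v : ℝ) ^ 3)
    (d2s : ∀ r : ℕ, n ≤ r →
      ∑ v ∈ annulus 4 r (r + 1), |G (v + unitVec ν + unitVec μ) - G (v + unitVec ν) - G (v + unitVec μ) + G v| ≤
        A 2 * Real.exp (-(δ / n) * ((r : ℝ) + 1)) / ((r : ℝ) + 1))
    {r : ℕ} (hr : n ≤ r) :
    ∑ w ∈ annulus 4 r (r + 1), |stKI μ ν N I G w| ≤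
      80 * (∑ i ∈ I, |bfCoeff N i| * (A ((bfP hμν i).a - 2) * (A ((bfQ hμν i).a - 2) * 2 ^ (bfQ hμν i).a))) / ((r : ℝ) + 1) *
        Real.exp (-(δ / n) * ((r : ℝ) + 1)) := by
  classical
  have hn0 : (0 : ℝ) < n := by exact_mod_cast (show 0 < n by omega)
  have hmem : ∀ i : BfIdx, i ∉ ({Sum.inr true} : Finset BfIdx) ↔ i ≠ Sum.inr true := fun i => by simp
  have hR' : ∀ i ∈ I, 0 ≤ A ((bfP hμν i).a - 2) := fun i _ => hA _
  have hS' : ∀ i ∈ I, 0 ≤ A ((bfQ hμν i).a - 2) * 2 ^ (bfQ hμν i).a := fun i _ => mul_nonneg (hA _) (by positivity)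
  have hsup : ∀ {r : ℕ} {w : Pt}, w ∈ annulus 4 r (r + 1) → (supNorm w : ℝ) = (r : ℝ) + 1 := fun hw => by
    rw [supNorm_eq_of_mem_sphere hw]; push_cast; ring
  have ht0 : (0 : ℝ) < (r : ℝ) + 1 := by positivity
  have hr1 : 1 ≤ r := le_trans (by omega) hr
  have h := shellTail_of_legRows (fun i _ => hdeg_bf hμν i (Finset.mem_univ i)) μ ν ({Sum.inr true} : Finset BfIdx) (r := r)
    (F := fun i w => stP μ ν G i w) (G := fun i w => stQ μ ν G i w) (cc₀ := bfCoeff N)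
    (R' := fun i => A ((bfP hμν i).a - 2)) (S' := fun i => A ((bfQ hμν i).a - 2) * 2 ^ (bfQ hμν i).a)
    (ε := Real.exp (-(δ / n) * ((r : ℝ) + 1))) hR' hS' ?_ ?_ ?_ ?_
  · simpa only [stKI] using h
  · -- tFpt: the designated first leg is the VALUE: pointwise tail from `d0` (exponential dropped)
    intro i _ hiF w hw
    rw [Finset.mem_singleton] at hiF
    subst hiF
    have hw0 : w ≠ 0 := ne_zero_of_mem_annulus hw
    show |stP μ ν G (Sum.inr true) w| ≤ _
    rw [stP_inr_true, a_bfP_inr_true_sub, a_bfP_inr_true]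
    have h := d0 w hw0
    rw [hsup hw] at h
    refine h.trans ?_
    have hx : (0 : ℝ) ≤ δ / (n : ℝ) * ((r : ℝ) + 1) := by positivity
    have hexp : Real.exp (-(δ / (n : ℝ)) * ((r : ℝ) + 1)) ≤ 1 := Real.exp_le_one_iff.mpr (by linarith)
    exact div_le_div_of_nonneg_right (mul_le_of_le_one_right (hA 0) hexp) (by positivity)
  · -- tGtsh: the designated second leg is the MIXED DIFFERENCE: shell tail `d2s`
    intro i _ hiF
    rw [Finset.mem_singleton] at hiF
    subst hiF
    show ∑ w ∈ annulus 4 r (r + 1), |stQ μ ν G (Sum.inr true) w| ≤ _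
    simp_rw [stQ_inr_true, a_bfQ_inr_true_sub, a_bfQ_inr_true]
    refine (d2s r hr).trans (tail_shape_le ht0 (Real.exp_pos _).le ?_)
    have := hA 2
    nlinarith [show (1 : ℝ) ≤ 80 * 2 ^ 4 by norm_num]
  · -- tGtpt: off the ghost index the second leg is a value or a gradient: pointwise tail (`2^b`-shifted), no `d2`
    intro i _ hiF w hw
    rw [hmem] at hiF
    have hc0 : (0 : ℝ) ≤ δ / (n : ℝ) := by positivity
    exact abs_stQ_low_le_of_decay hμν i hiF hA hc0 d0 d1 hr1 hw
  · -- tFtsh: off the ghost index the first leg is the mixed difference (`d2s`) or the `μ`-gradient at `w` (`d1`, summed)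
    intro i _ hiF
    rw [hmem] at hiF
    show ∑ w ∈ annulus 4 r (r + 1), |stP μ ν G i w| ≤ _
    rcases stP_low hμν i hiF G with ⟨e, ha2, ha⟩ | ⟨e, ha1, ha⟩
    · simp_rw [e, ha2, ha]
      refine (d2s r hr).trans (tail_shape_le ht0 (Real.exp_pos _).le ?_)
      linarith [hA 2]
    · simp_rw [e, ha1, ha]
      have hpt : ∀ w ∈ annulus 4 r (r + 1), |G (w + unitVec μ) - G w| ≤
          A 1 / ((r : ℝ) + 1) ^ 3 * Real.exp (-(δ / (n : ℝ)) * ((r : ℝ) + 1)) := by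
        intro w hw
        have h := d1 w (ne_zero_of_mem_annulus hw) μ
        rw [hsup hw] at h
        refine h.trans (le_of_eq ?_)
        ring
      exact (shell_sum_le_of_pointwise (by have := hA 1; positivity) hpt).trans (le_of_eq (by ring))

end OneFamily

/-! ## §2 Two families, one scale: the re-legging bound in shell currency -/

section Relegging

/-- [folklore] arithmetic of the tail constant: `80E(1 + n/δ)/(n+1) ≤ 80E(1 + 1/δ)` for `E ≥ 0`, `δ > 0`, `n ≥ 0`. -/
theorem tail_const_le {E δ n : ℝ} (hE : 0 ≤ E) (hδ : 0 < δ) (hn : 0 ≤ n) :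
    80 * E * (1 + n / δ) / (n + 1) ≤ 80 * E * (1 + 1 / δ) := by
  have hn1 : 0 < n + 1 := by linarith
  rw [div_le_iff₀ hn1]
  have hδ' : 0 ≤ 1 / δ := by positivity
  have hkey : 1 + n / δ ≤ (1 + 1 / δ) * (n + 1) := by
    rw [show n / δ = n * (1 / δ) by ring]
    nlinarith
  calc 80 * E * (1 + n / δ) ≤ 80 * E * ((1 + 1 / δ) * (n + 1)) := mul_le_mul_of_nonneg_left hkey (by positivity)
    _ = 80 * E * (1 + 1 / δ) * (n + 1) := by ring

/-- [folklore] **A2′-SHELL — THE RE-LEGGING BOUND AT ONE SCALE, SHELL CURRENCY FOR THE MIXED DIFFERENCES.**  Two leg families `G₁`, `G₂`,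
EACH obeying the pointwise rows `h0/h1/d0/d1` and the SHELL-ℓ¹ rows `h2s` (window shells `r + 1 ≤ n`) / `d2s` (exterior shells `r ≥ n`) at one
scale `n ≥ 2` ⟹ for every index sub-family `I`,
`|fullSum (stKI I G₁) − fullSum (stKI I G₂)| ≤ 2·Dsh + 2·(80·Et·(1 + 1/δ))` — leaf-10's `GhostRelegging.abs_fullSum_stKI_sub_le` with `h2`/`d2`
replaced by their shell forms (pointwise ⟹ shell, so this is strictly more general). -/
theorem abs_fullSum_stKI_sub_le_shell (hμν : μ ≠ ν) (N : ℝ) (I : Finset BfIdx) {n : ℕ} (hn : 2 ≤ n) {G₁ G₂ : Pt → ℝ}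
    {D A : ℕ → ℝ} (hD : ∀ j, 0 ≤ D j) (hA : ∀ j, 0 ≤ A j) {δ : ℝ} (hδ : 0 < δ)
    (h0₁ : ∀ v, |G₁ v - gFree v| ≤ D 0 / (n : ℝ) ^ 2)
    (h1₁ : ∀ v (ρ : Fin 4), |(G₁ (v + unitVec ρ) - gFree (v + unitVec ρ)) - (G₁ v - gFree v)| ≤ D 1 / (n : ℝ) ^ 3)
    (h2s₁ : ∀ r : ℕ, r + 1 ≤ n →
      ∑ v ∈ annulus 4 r (r + 1), |(G₁ (v + unitVec ν + unitVec μ) - gFree (v + unitVec ν + unitVec μ)) -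
          (G₁ (v + unitVec ν) - gFree (v + unitVec ν)) - (G₁ (v + unitVec μ) - gFree (v + unitVec μ)) + (G₁ v - gFree v)| ≤ D 2 / (n : ℝ))
    (d0₁ : ∀ v : Pt, v ≠ 0 → |G₁ v| ≤ A 0 * Real.exp (-(δ / n) * supNorm v) / (supNorm v : ℝ) ^ 2)
    (d1₁ : ∀ v : Pt, v ≠ 0 → ∀ ρ : Fin 4, |G₁ (v + unitVec ρ) - G₁ v| ≤ A 1 * Real.exp (-(δ / n) * supNorm v) / (supNorm v : ℝ) ^ 3)
    (d2s₁ : ∀ r : ℕ, n ≤ r →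
      ∑ v ∈ annulus 4 r (r + 1), |G₁ (v + unitVec ν + unitVec μ) - G₁ (v + unitVec ν) - G₁ (v + unitVec μ) + G₁ v| ≤
        A 2 * Real.exp (-(δ / n) * ((r : ℝ) + 1)) / ((r : ℝ) + 1))
    (h0₂ : ∀ v, |G₂ v - gFree v| ≤ D 0 / (n : ℝ) ^ 2)
    (h1₂ : ∀ v (ρ : Fin 4), |(G₂ (v + unitVec ρ) - gFree (v + unitVec ρ)) - (G₂ v - gFree v)| ≤ D 1 / (n : ℝ) ^ 3)
    (h2s₂ : ∀ r : ℕ, r + 1 ≤ n →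
      ∑ v ∈ annulus 4 r (r + 1), |(G₂ (v + unitVec ν + unitVec μ) - gFree (v + unitVec ν + unitVec μ)) -
          (G₂ (v + unitVec ν) - gFree (v + unitVec ν)) - (G₂ (v + unitVec μ) - gFree (v + unitVec μ)) + (G₂ v - gFree v)| ≤ D 2 / (n : ℝ))
    (d0₂ : ∀ v : Pt, v ≠ 0 → |G₂ v| ≤ A 0 * Real.exp (-(δ / n) * supNorm v) / (supNorm v : ℝ) ^ 2)
    (d1₂ : ∀ v : Pt, v ≠ 0 → ∀ ρ : Fin 4, |G₂ (v + unitVec ρ) - G₂ v| ≤ A 1 * Real.exp (-(δ / n) * supNorm v) / (supNorm v : ℝ) ^ 3)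
    (d2s₂ : ∀ r : ℕ, n ≤ r →
      ∑ v ∈ annulus 4 r (r + 1), |G₂ (v + unitVec ν + unitVec μ) - G₂ (v + unitVec ν) - G₂ (v + unitVec μ) + G₂ v| ≤
        A 2 * Real.exp (-(δ / n) * ((r : ℝ) + 1)) / ((r : ℝ) + 1)) :
    |fullSum (stKI μ ν N I G₁) - fullSum (stKI μ ν N I G₂)| ≤
      2 * (∑ i ∈ I, |bfCoeff N i| *
        (80 * (((bfP hμν i).A + (bfP hμν i).B) * (80 * D ((bfQ hμν i).a - 2)) +
            80 * D ((bfP hμν i).a - 2) * ((bfQ hμν i).A + (bfQ hμν i).B)) +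
          80 * D ((bfP hμν i).a - 2) * (80 * D ((bfQ hμν i).a - 2)))) +
      2 * (80 * (∑ i ∈ I, |bfCoeff N i| * (A ((bfP hμν i).a - 2) * (A ((bfQ hμν i).a - 2) * 2 ^ (bfQ hμν i).a))) * (1 + 1 / δ)) := by
  set Dsh : ℝ := ∑ i ∈ I, |bfCoeff N i| *
      (80 * (((bfP hμν i).A + (bfP hμν i).B) * (80 * D ((bfQ hμν i).a - 2)) +
          80 * D ((bfP hμν i).a - 2) * ((bfQ hμν i).A + (bfQ hμν i).B)) +
        80 * D ((bfP hμν i).a - 2) * (80 * D ((bfQ hμν i).a - 2))) with hDsh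
  set Et : ℝ := ∑ i ∈ I, |bfCoeff N i| * (A ((bfP hμν i).a - 2) * (A ((bfQ hμν i).a - 2) * 2 ^ (bfQ hμν i).a)) with hEt
  have hDsh0 : 0 ≤ Dsh := shellWinConst_nonneg hμν N I hD
  have hEt0 : 0 ≤ Et := tailConst_nonneg hμν N I hA
  have hn1 : 1 ≤ n := by omega
  have hn0 : (0 : ℝ) < n := by exact_mod_cast (show 0 < n by omega)
  -- tails: per family, `|fullSum K − psum K n| ≤ 80·Et·(1 + n/δ)/(n+1) ≤ 80·Et·(1 + 1/δ)`
  have htail : ∀ {G : Pt → ℝ},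
      (∀ v : Pt, v ≠ 0 → |G v| ≤ A 0 * Real.exp (-(δ / n) * supNorm v) / (supNorm v : ℝ) ^ 2) →
      (∀ v : Pt, v ≠ 0 → ∀ ρ : Fin 4, |G (v + unitVec ρ) - G v| ≤ A 1 * Real.exp (-(δ / n) * supNorm v) / (supNorm v : ℝ) ^ 3) →
      (∀ r : ℕ, n ≤ r →
        ∑ v ∈ annulus 4 r (r + 1), |G (v + unitVec ν + unitVec μ) - G (v + unitVec ν) - G (v + unitVec μ) + G v| ≤
          A 2 * Real.exp (-(δ / n) * ((r : ℝ) + 1)) / ((r : ℝ) + 1)) →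
      |fullSum (stKI μ ν N I G) - psum (stKI μ ν N I G) n| ≤ 80 * Et * (1 + 1 / δ) := by
    intro G d0 d1 d2s
    have h := abs_fullSum_sub_psum_le_shell (K := stKI μ ν N I G) (M := n) (E := Et) (Lr := (n : ℝ)) hEt0 hδ hn0
      (fun r hr => shellTail_stKI hμν N I hn hA hδ d0 d1 d2s hr) (R := n) le_rfl
    exact h.trans (tail_const_le hEt0 hδ hn0.le)
  have ht₁ := htail d0₁ d1₁ d2s₁
  have ht₂ := htail d0₂ d1₂ d2s₂
  -- window: the difference of the two kernels shell by shell is within `2·Dsh/n`, on `n` shells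
  have hwin : |psum (stKI μ ν N I G₁) n - psum (stKI μ ν N I G₂) n| ≤ 2 * Dsh := by
    rw [psum_def, psum_def]
    refine window_sub_le_of_shellRows (K := stKI μ ν N I G₁) (K0 := stKI μ ν N I G₂) (by positivity) hn1 le_rfl fun r hr => ?_
    have h₁ := shellWindow_stKI hμν N I hn hD h0₁ h1₁ h2s₁ hr
    have h₂ := shellWindow_stKI hμν N I hn hD h0₂ h1₂ h2s₂ hr
    calc ∑ w ∈ annulus 4 r (r + 1), |stKI μ ν N I G₁ w - stKI μ ν N I G₂ w|
        ≤ ∑ w ∈ annulus 4 r (r + 1), (|stKI μ ν N I G₁ w - stKI μ ν N I gFree w| + |stKI μ ν N I G₂ w - stKI μ ν N I gFree w|) := by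
          refine Finset.sum_le_sum fun w _ => ?_
          rw [← abs_sub_comm (stKI μ ν N I gFree w) (stKI μ ν N I G₂ w)]
          exact abs_sub_le _ _ _
      _ ≤ Dsh / n + Dsh / n := by rw [Finset.sum_add_distrib]; exact add_le_add h₁ h₂
      _ = 2 * Dsh / n := by ring
  -- assemble
  calc |fullSum (stKI μ ν N I G₁) - fullSum (stKI μ ν N I G₂)|
      = |(fullSum (stKI μ ν N I G₁) - psum (stKI μ ν N I G₁) n) + (psum (stKI μ ν N I G₁) n - psum (stKI μ ν N I G₂) n)
          - (fullSum (stKI μ ν N I G₂) - psum (stKI μ ν N I G₂) n)| := by ring_nf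
    _ ≤ |(fullSum (stKI μ ν N I G₁) - psum (stKI μ ν N I G₁) n) + (psum (stKI μ ν N I G₁) n - psum (stKI μ ν N I G₂) n)|
          + |fullSum (stKI μ ν N I G₂) - psum (stKI μ ν N I G₂) n| := abs_sub _ _
    _ ≤ |fullSum (stKI μ ν N I G₁) - psum (stKI μ ν N I G₁) n| + |psum (stKI μ ν N I G₁) n - psum (stKI μ ν N I G₂) n|
          + |fullSum (stKI μ ν N I G₂) - psum (stKI μ ν N I G₂) n| := by gcongr; exact abs_add_le _ _
    _ ≤ 80 * Et * (1 + 1 / δ) + 2 * Dsh + 80 * Et * (1 + 1 / δ) := add_le_add (add_le_add ht₁ hwin) ht₂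
    _ = 2 * Dsh + 2 * (80 * Et * (1 + 1 / δ)) := by ring

end Relegging

end

end Summit.QuantumFields.BalabanUV.Beta.D1BFx.GhostReleggingShell
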